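import Literature.Barriers.Parity.SiegelZeroDichotomyChowlaModel
import Literature.Barriers.Parity.SiegelZeroDichotomyChowlaDivisorSums
import Mathlib.Algebra.GCDMonoid.Finset
import Mathlib.Algebra.GCDMonoid.Nat
import HarnessLib

/-!
# Step (iii) of Tao–Teräväinen at `k = 0`, inputs: Lemma 6.1 (the majorant of `λ♭_Siegel`, named
# fact) and the count of a system of shifted divisibility conditions (Lemma 3.3 at `k = 0`)

Topic `Literature/Barriers/Parity`, sub-namespace `TaoTeravainen`; part of the proof DAG of
`Literature.Barriers.Parity.TaoTeravainen2021_chowla` (`SiegelZeroDichotomyChowla.lean`), towards the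
named fact `TaoTeravainen2021_prop63_k0` (Proposition 6.3 at `k = 0`:
`𝔼_{n ≤ x} ∏ⱼ λ_Siegel(n+h'ⱼ) ≈ 𝔼_{n ≤ x} ∏ⱼ λ♯_Siegel(n+h'ⱼ)`). Contents:

* `TaoTeravainen2021_lemma61` — NAMED FACT: **Lemma 6.1** of the source: with
  `λ♭_Siegel := λ_Siegel - λ♯_Siegel` ((6.1)–(6.3)), "For any `n ≤ 2x`, we have `λ♭_Siegel(n) ≪ H(n)`
  (6.4) where `H(n) := ∑_{d ≤ D: d∣n} α(d)` (6.5) and `α(d)` are non-negative quantities obeying the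
  bounds `∑_{d ≤ D} τ(d)^A α(d)/d ≪_A exp(-⅛ log_R D)` (6.6) for any `A ≥ 1`" (the `α(d)` of the
  printed proof are explicit and do not depend on `A`; Remark 6.2: the right side is
  `≪_A log^{-A} η` by (2.12));
* PROVED, the count behind **Lemma 3.3 / Lemma 3.4 at `k = 0`**: for distinct shifts `a ∈ J`
  (`1 ≤ a ≤ h_max`) and moduli `f a ≥ 1`, the `n ≤ x` with `f a ∣ n + a` for all `a ∈ J` number at
  most `x h_max^{#J·#J}/∏ f a + 1` (`card_filter_system_le`): two solutions differ by a multiple of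
  `lcm f` (Lemma 3.3 (ii): "there is a unique residue class `a (d)`", `d = [d₁,…,d_{k'}]`), and
  `∏ f a ≤ lcm f · ∏_{a ≠ c} (f a, f c)` (`prod_le_lcm_mul_pairGcdProd`) with `(f a, f c) ∣ a - c`
  when the system is solvable (Lemma 3.3: "`d ≍ d₁⋯d_{k'}`" since
  "`d₁⋯d_{k'}/[d₁,…,d_{k'}] ∣ ∏_{i<j} (dᵢ,dⱼ)`" and "`(dᵢ,dⱼ)` divides `hᵢ-hⱼ`");
* PROVED: the resulting bound for correlations of a divisor-sum majorant
  `H(n) = ∑_{d ≤ N, d ∣ n} α(d)`, `α ≥ 0`: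
  `∑_{n ≤ x} ∏_{a ∈ J} H(n+a) ≤ x h_max^{#J·#J} (∑_{d ≤ N} α(d)/d)^{#J} + (∑_{d ≤ N} α(d))^{#J}`
  (`sum_prod_majorant_le`), the `k = 0` case of the computation proving (6.13).
  [cite: TaoTeravainen2021, Lemma 6.1, Remark 6.2, Lemma 3.3 and the proof of Proposition 6.3]
-/

noncomputable section

open Finset

namespace Literature.Barriers.Parity

open TaoTeravainen

/-! ### Lemma 6.1 (named fact) -/

/-- **Tao–Teräväinen 2022, Lemma 6.1** (the majorant of `λ♭_Siegel = λ_Siegel - λ♯_Siegel`), at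
`k = 0` (`R = x^{1/log^{1/5} η}`, `D = x^{ε₀/(10ℓ)}`), under the standing assumptions of §2.1:
for fixed `ℓ ≥ 1` and cutoff `ψ`, after shrinking `ε₀`, there are `C` (for (6.4)), constants
`K(A)` (for (6.6), "`≪_A`") and `η₁` such that for every Siegel zero with `η ≥ η₁` and every
`q^{1/2+ε₀} ≤ x ≤ q^{η^{1/2}}` there are non-negative `α(d)` with
(6.4) `|λ_Siegel(n) - λ♯_Siegel(n)| ≤ C ∑_{d ≤ D, d ∣ n} α(d)` for all `1 ≤ n ≤ 2x`, and
(6.6) `∑_{d ≤ D} τ(d)^A α(d)/d ≤ K(A) exp(-⅛ log D/log R)` for all `A ≥ 1`.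
A NAMED FACT (source inputs: Fourier expansion of `ψ_{>D}`, Euler products, Landreau's inequality
Lemma 3.1 (i), Mertens' theorem). [cite: TaoTeravainen2021, Lemma 6.1 (with (6.1)–(6.6), §2.1, (2.3), (2.4))] -/
def TaoTeravainen2021_lemma61 : Prop :=
  ∀ ℓ : ℕ, 1 ≤ ℓ → ∀ ψ : ℝ → ℝ, IsSmoothCutoff ψ →
    ∃ ε₁ : ℝ, 0 < ε₁ ∧ ∀ ε₀ : ℝ, 0 < ε₀ → ε₀ ≤ ε₁ →
      ∃ (C : ℝ) (K : ℝ → ℝ) (η₁ : ℝ), ∀ (q : ℕ) [NeZero q] (χ : DirichletCharacter ℂ q) (η : ℝ),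
        IsSiegelZero χ η → η₁ ≤ η →
          ∀ x : ℕ, (q : ℝ) ^ ((1 : ℝ) / 2 + ε₀) ≤ x → (x : ℝ) ≤ (q : ℝ) ^ Real.sqrt η →
            ∃ α : ℕ → ℝ, (∀ d, 0 ≤ α d) ∧
              (∀ n : ℕ, 1 ≤ n → (n : ℝ) ≤ 2 * x →
                |liouvilleSiegel χ (scaleR η x) n -
                    liouvilleSiegelSharp χ ψ (scaleR η x) (scaleD ℓ ε₀ x) n| ≤
                  C * ∑ d ∈ (Icc 1 ⌊scaleD ℓ ε₀ x⌋₊).filter (· ∣ n), α d) ∧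
              (∀ A : ℝ, 1 ≤ A →
                ∑ d ∈ Icc 1 ⌊scaleD ℓ ε₀ x⌋₊, (#d.divisors : ℝ) ^ A * α d / d ≤
                  K A * Real.exp (-(1 / 8) * (Real.log (scaleD ℓ ε₀ x) / Real.log (scaleR η x))))

namespace TaoTeravainen

/-! ### `lcm` against the product: `∏ f ≤ lcm f · ∏_{a ≠ c} (f a, f c)` -/

/-- The product of the `gcd`s over ordered pairs of distinct indices. [folklore] -/
def pairGcdProd (J : Finset ℕ) (f : ℕ → ℕ) : ℕ :=
  ∏ a ∈ J, ∏ c ∈ J.erase a, Nat.gcd (f a) (f c)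

/-- `(d, lcm_{c ∈ s} f c) ∣ ∏_{c ∈ s} (d, f c)`. [folklore] -/
theorem gcd_lcm_dvd_prod_gcd (d : ℕ) (s : Finset ℕ) (f : ℕ → ℕ) :
    Nat.gcd d (s.lcm f) ∣ ∏ c ∈ s, Nat.gcd d (f c) := by
  classical
  induction s using Finset.induction_on with
  | empty => simp
  | insert c s hc ih =>
    rw [Finset.lcm_insert, prod_insert hc, lcm_eq_nat_lcm]
    calc Nat.gcd d (Nat.lcm (f c) (s.lcm f)) ∣ Nat.gcd d (f c * s.lcm f) :=
          Nat.gcd_dvd_gcd_of_dvd_right _ (Nat.lcm_dvd_mul _ _)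
      _ ∣ Nat.gcd d (f c) * Nat.gcd d (s.lcm f) := Nat.gcd_mul_right_dvd_mul_gcd _ _ _
      _ ∣ Nat.gcd d (f c) * ∏ c ∈ s, Nat.gcd d (f c) := Nat.mul_dvd_mul_left _ ih

/-- `pairGcdProd` of an insertion. [folklore] -/
theorem pairGcdProd_insert {b : ℕ} {s : Finset ℕ} (hb : b ∉ s) (f : ℕ → ℕ) :
    pairGcdProd (insert b s) f =
      (∏ c ∈ s, Nat.gcd (f b) (f c)) * ((∏ a ∈ s, Nat.gcd (f a) (f b)) * pairGcdProd s f) := by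
  classical
  unfold pairGcdProd
  rw [prod_insert hb, erase_insert hb]
  congr 1
  rw [← prod_mul_distrib]
  refine prod_congr rfl fun a ha => ?_
  have hab : a ≠ b := fun h => hb (h ▸ ha)
  rw [erase_insert_of_ne hab.symm, prod_insert (fun h => hb (mem_of_mem_erase h))]

/-- `pairGcdProd` is positive when all `f a ≥ 1`. [folklore] -/
theorem pairGcdProd_pos (J : Finset ℕ) (f : ℕ → ℕ) (hf : ∀ a ∈ J, 0 < f a) :
    0 < pairGcdProd J f :=
  prod_pos fun a ha => prod_pos fun _ _ => Nat.gcd_pos_of_pos_left _ (hf a ha)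

/-- **`∏_{a ∈ J} f a ≤ (lcm_{a ∈ J} f a) · ∏_{a ≠ c} (f a, f c)`** (the elementary form of
"`d₁⋯d_{k'}/[d₁,…,d_{k'}] ∣ ∏_{i<j} (dᵢ,dⱼ)`" in the proof of Lemma 3.3).
[cite: TaoTeravainen2021, Lemma 3.3 (proof)] -/
theorem prod_le_lcm_mul_pairGcdProd (J : Finset ℕ) (f : ℕ → ℕ) (hf : ∀ a ∈ J, 0 < f a) :
    ∏ a ∈ J, f a ≤ J.lcm f * pairGcdProd J f := by
  classical
  induction J using Finset.induction_on with
  | empty => simp [pairGcdProd]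
  | insert b s hb ih =>
    have hfs : ∀ a ∈ s, 0 < f a := fun a ha => hf a (mem_insert_of_mem ha)
    have hfb : 0 < f b := hf b (mem_insert_self b s)
    rw [prod_insert hb, Finset.lcm_insert, lcm_eq_nat_lcm, pairGcdProd_insert hb]
    set L' := s.lcm f with hL'
    set G := ∏ c ∈ s, Nat.gcd (f b) (f c) with hG
    set G' := ∏ a ∈ s, Nat.gcd (f a) (f b) with hG'
    have hG0 : 0 < G := prod_pos fun c _ => Nat.gcd_pos_of_pos_left _ hfb
    have hG'1 : 1 ≤ G' := prod_pos fun a ha => Nat.gcd_pos_of_pos_left _ (hfs a ha)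
    have hgcd : Nat.gcd (f b) L' ≤ G :=
      Nat.le_of_dvd hG0 (gcd_lcm_dvd_prod_gcd (f b) s f)
    have hkey : f b * L' = Nat.gcd (f b) L' * Nat.lcm (f b) L' := (Nat.gcd_mul_lcm _ _).symm
    calc f b * ∏ a ∈ s, f a ≤ f b * (L' * pairGcdProd s f) := Nat.mul_le_mul_left _ (ih hfs)
      _ = Nat.gcd (f b) L' * Nat.lcm (f b) L' * pairGcdProd s f := by rw [← mul_assoc, hkey]
      _ ≤ G * Nat.lcm (f b) L' * pairGcdProd s f :=
          Nat.mul_le_mul_right _ (Nat.mul_le_mul_right _ hgcd)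
      _ ≤ G * Nat.lcm (f b) L' * pairGcdProd s f * G' := Nat.le_mul_of_pos_right _ hG'1
      _ = Nat.lcm (f b) L' * (G * (G' * pairGcdProd s f)) := by ring

/-! ### Counting the solutions of `f a ∣ n + a` (`a ∈ J`) up to `x` -/

/-- **Lemma 3.3 at `k = 0`, counting form.** For distinct shifts `a ∈ J` with `a ≤ h_max`
(`h_max ≥ 1`) and moduli `f a ≥ 1`:
`#{1 ≤ n ≤ x : f a ∣ n + a ∀ a ∈ J} ≤ x h_max^{#J·#J}/∏_{a ∈ J} f a + 1`
(two solutions differ by a multiple of `lcm f`; when a solution exists `(f a, f c) ∣ a - c`, so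
`lcm f ≥ ∏ f a / h_max^{#J·#J}`). [cite: TaoTeravainen2021, Lemma 3.3] -/
theorem card_filter_system_le (J : Finset ℕ) (f : ℕ → ℕ) (hf : ∀ a ∈ J, 0 < f a) {hmax : ℕ}
    (hm : 1 ≤ hmax) (hJ : ∀ a ∈ J, a ≤ hmax) (x : ℕ) :
    (#((Icc 1 x).filter fun n => ∀ a ∈ J, f a ∣ n + a) : ℝ) ≤
      (x : ℝ) * (hmax : ℝ) ^ (#J * #J) / (∏ a ∈ J, (f a : ℝ)) + 1 := by
  classical
  set S := (Icc 1 x).filter fun n => ∀ a ∈ J, f a ∣ n + a with hS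
  have hP0 : (0 : ℝ) < ∏ a ∈ J, (f a : ℝ) := prod_pos fun a ha => by exact_mod_cast hf a ha
  rcases S.eq_empty_or_nonempty with hSe | ⟨n₀, hn₀⟩
  · rw [hSe, card_empty, Nat.cast_zero]
    positivity
  rw [hS, mem_filter, mem_Icc] at hn₀
  obtain ⟨-, hsol⟩ := hn₀
  -- the modulus
  set L : ℕ := J.lcm f with hL
  have hLdvd : ∀ a ∈ J, f a ∣ L := fun a ha => Finset.dvd_lcm ha
  have hLP : L ∣ ∏ a ∈ J, f a := Finset.lcm_dvd fun a ha => dvd_prod_of_mem f ha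
  have hPpos : 0 < ∏ a ∈ J, f a := prod_pos hf
  have hL0 : 0 < L := Nat.pos_of_dvd_of_pos hLP hPpos
  -- every solution is `≡ n₀ (mod L)`: `L ∣ n + c` with `c = L - n₀ % L`
  set c : ℕ := L - n₀ % L with hc
  have hc0 : L ∣ n₀ + c := by
    have h1 := Nat.div_add_mod n₀ L
    have h2 : n₀ % L < L := Nat.mod_lt _ hL0
    refine ⟨n₀ / L + 1, ?_⟩
    rw [hc]
    zify [h2.le] at h1 ⊢
    linarith
  have hsub : S ⊆ (Icc 1 x).filter fun n => L ∣ n + c := by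
    intro n hn
    rw [hS, mem_filter] at hn
    rw [mem_filter]
    refine ⟨hn.1, ?_⟩
    rcases le_total n₀ n with hle | hle
    · have hdiff : L ∣ n - n₀ := by
        refine Finset.lcm_dvd fun a ha => ?_
        have := Nat.dvd_sub (hn.2 a ha) (hsol a ha)
        rwa [Nat.add_sub_add_right] at this
      have : n + c = (n - n₀) + (n₀ + c) := by omega
      rw [this]
      exact Nat.dvd_add hdiff hc0
    · have hdiff : L ∣ n₀ - n := by
        refine Finset.lcm_dvd fun a ha => ?_
        have := Nat.dvd_sub (hsol a ha) (hn.2 a ha)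
        rwa [Nat.add_sub_add_right] at this
      have h1 : n₀ + c = (n₀ - n) + (n + c) := by omega
      rw [h1] at hc0
      exact (Nat.dvd_add_right hdiff).mp hc0
  -- the pairwise gcds are `≤ h_max`
  have hgcd : ∀ a ∈ J, ∀ d ∈ J.erase a, Nat.gcd (f a) (f d) ≤ hmax := by
    intro a ha d hd
    have hda : d ≠ a := ne_of_mem_erase hd
    have hd' : d ∈ J := mem_of_mem_erase hd
    have h1 : Nat.gcd (f a) (f d) ∣ n₀ + a := (Nat.gcd_dvd_left _ _).trans (hsol a ha)
    have h2 : Nat.gcd (f a) (f d) ∣ n₀ + d := (Nat.gcd_dvd_right _ _).trans (hsol d hd')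
    rcases lt_or_gt_of_ne hda with hlt | hlt
    · have h3 : Nat.gcd (f a) (f d) ∣ a - d := by
        have := Nat.dvd_sub h1 h2
        rwa [Nat.add_sub_add_left] at this
      exact (Nat.le_of_dvd (by omega) h3).trans (by have := hJ a ha; omega)
    · have h3 : Nat.gcd (f a) (f d) ∣ d - a := by
        have := Nat.dvd_sub h2 h1
        rwa [Nat.add_sub_add_left] at this
      exact (Nat.le_of_dvd (by omega) h3).trans (by have := hJ d hd'; omega)
  have hpair : pairGcdProd J f ≤ hmax ^ (#J * #J) := by
    unfold pairGcdProd
    calc ∏ a ∈ J, ∏ d ∈ J.erase a, Nat.gcd (f a) (f d) ≤ ∏ a ∈ J, ∏ _d ∈ J.erase a, hmax :=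
          prod_le_prod' fun a ha => prod_le_prod' fun d hd => hgcd a ha d hd
      _ = hmax ^ (∑ a ∈ J, #(J.erase a)) := by
          rw [prod_congr rfl fun a _ => prod_const hmax, prod_pow_eq_pow_sum]
      _ ≤ hmax ^ (#J * #J) := by
          refine Nat.pow_le_pow_right hm ?_
          calc ∑ a ∈ J, #(J.erase a) ≤ ∑ _a ∈ J, #J := sum_le_sum fun a _ => card_erase_le
            _ = #J * #J := by rw [sum_const, smul_eq_mul]
  -- assemble
  have hcount : (#((Icc 1 x).filter fun n => L ∣ n + c) : ℝ) ≤ (x : ℝ) / L + 1 :=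
    card_filter_dvd_add_le L x c hL0
  have hprod : (∏ a ∈ J, (f a : ℝ)) ≤ (L : ℝ) * (hmax : ℝ) ^ (#J * #J) := by
    have h1 := prod_le_lcm_mul_pairGcdProd J f hf
    have h2 : ((∏ a ∈ J, f a : ℕ) : ℝ) ≤ ((L * pairGcdProd J f : ℕ) : ℝ) := by exact_mod_cast h1
    push_cast at h2
    refine h2.trans (mul_le_mul_of_nonneg_left ?_ (Nat.cast_nonneg _))
    exact_mod_cast hpair
  have hL0' : (0 : ℝ) < L := by exact_mod_cast hL0
  calc (#S : ℝ) ≤ #((Icc 1 x).filter fun n => L ∣ n + c) := by exact_mod_cast card_le_card hsub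
    _ ≤ (x : ℝ) / L + 1 := hcount
    _ ≤ (x : ℝ) * (hmax : ℝ) ^ (#J * #J) / (∏ a ∈ J, (f a : ℝ)) + 1 := by
        refine add_le_add ?_ le_rfl
        rw [div_le_div_iff₀ hL0' hP0]
        calc (x : ℝ) * ∏ a ∈ J, (f a : ℝ) ≤ (x : ℝ) * ((L : ℝ) * (hmax : ℝ) ^ (#J * #J)) :=
              mul_le_mul_of_nonneg_left hprod (Nat.cast_nonneg _)
          _ = (x : ℝ) * (hmax : ℝ) ^ (#J * #J) * L := by ring

/-! ### Correlations of a divisor-sum majorant -/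

/-- **Correlations of `H(n) = ∑_{d ≤ N, d ∣ n} α(d)`** (`α ≥ 0`; the `k = 0` case of the bound
for (6.13)): for distinct shifts `a ∈ J` with `1 ≤ a ≤ h_max`,
`∑_{n=1}^{x} ∏_{a ∈ J} H(n+a) ≤ x h_max^{#J·#J} (∑_{d ≤ N} α(d)/d)^{#J} + (∑_{d ≤ N} α(d))^{#J}`.
[cite: TaoTeravainen2021, proof of Proposition 6.3 ((6.13)) with Lemma 3.3] -/
theorem sum_prod_majorant_le (J : Finset ℕ) {hmax : ℕ} (hm : 1 ≤ hmax) (hJ : ∀ a ∈ J, a ≤ hmax)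
    {α : ℕ → ℝ} (hα : ∀ d, 0 ≤ α d) (N x : ℕ) :
    ∑ n ∈ Icc 1 x, ∏ a ∈ J, (∑ d ∈ (Icc 1 N).filter (· ∣ n + a), α d) ≤
      (x : ℝ) * (hmax : ℝ) ^ (#J * #J) * (∑ d ∈ Icc 1 N, α d / d) ^ #J +
        (∑ d ∈ Icc 1 N, α d) ^ #J := by
  classical
  -- expand the product of divisor sums
  have hexp : ∀ n : ℕ, ∏ a ∈ J, (∑ d ∈ (Icc 1 N).filter (· ∣ n + a), α d) =
      ∑ p ∈ J.pi (fun _ => Icc 1 N), ∏ a ∈ J.attach,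
        (if p a.1 a.2 ∣ n + a.1 then α (p a.1 a.2) else 0) := by
    intro n
    rw [← Finset.prod_sum J (fun _ => Icc 1 N) (fun a d => if d ∣ n + a then α d else 0)]
    refine prod_congr rfl fun a _ => ?_
    rw [sum_filter]
  simp_rw [hexp]
  rw [sum_comm]
  -- each tuple: `(∏ α) · #{n : system}`
  have hterm : ∀ p ∈ J.pi (fun _ => Icc 1 N),
      ∑ n ∈ Icc 1 x, ∏ a ∈ J.attach, (if p a.1 a.2 ∣ n + a.1 then α (p a.1 a.2) else 0) ≤
        (∏ a ∈ J.attach, α (p a.1 a.2)) *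
          ((x : ℝ) * (hmax : ℝ) ^ (#J * #J) / (∏ a ∈ J.attach, (p a.1 a.2 : ℝ)) + 1) := by
    intro p hp
    have hp1 : ∀ a ∈ J.attach, 0 < p a.1 a.2 := by
      intro a _
      rw [Finset.mem_pi] at hp
      exact (mem_Icc.mp (hp a.1 a.2)).1
    have hA0 : 0 ≤ ∏ a ∈ J.attach, α (p a.1 a.2) := prod_nonneg fun a _ => hα _
    have hpt : ∀ n ∈ Icc 1 x,
        (∏ a ∈ J.attach, (if p a.1 a.2 ∣ n + a.1 then α (p a.1 a.2) else 0)) ≤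
          (∏ a ∈ J.attach, α (p a.1 a.2)) *
            (if (∀ a ∈ J.attach, p a.1 a.2 ∣ n + a.1) then 1 else 0) := by
      intro n _
      rw [prod_ite_zero]
      split_ifs <;> simp
    refine (sum_le_sum hpt).trans ?_
    rw [← mul_sum]
    refine mul_le_mul_of_nonneg_left ?_ hA0
    have hcnt : ∑ n ∈ Icc 1 x, (if (∀ a ∈ J.attach, p a.1 a.2 ∣ n + a.1) then (1 : ℝ) else 0) =
        #((Icc 1 x).filter fun n => ∀ a ∈ J.attach, p a.1 a.2 ∣ n + a.1) := by
      rw [Finset.natCast_card_filter]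
    rw [hcnt]
    -- the count, via `piFun`
    have hpf : ∀ a (ha : a ∈ J), piFun J p a = p a ha := fun a ha => by simp [piFun, ha]
    have hcount := card_filter_system_le J (piFun J p)
      (fun a ha => by rw [hpf a ha]; exact hp1 ⟨a, ha⟩ (mem_attach _ _)) hm hJ x
    have e1 : ((Icc 1 x).filter fun n => ∀ a ∈ J.attach, p a.1 a.2 ∣ n + a.1) =
        (Icc 1 x).filter fun n => ∀ a ∈ J, piFun J p a ∣ n + a := by
      refine filter_congr fun n _ => ⟨fun h a ha => ?_, fun h a _ => ?_⟩
      · rw [hpf a ha]; exact h ⟨a, ha⟩ (mem_attach _ _)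
      · rw [← hpf a.1 a.2]; exact h a.1 a.2
    have e2 : (∏ a ∈ J.attach, (p a.1 a.2 : ℝ)) = ∏ a ∈ J, (piFun J p a : ℝ) :=
      prod_attach_eq_prod_piFun J p (fun _ d => (d : ℝ))
    rw [e1, e2]
    exact hcount
  refine (sum_le_sum hterm).trans ?_
  -- sum over tuples: factorise
  have hsplit : ∀ p ∈ J.pi (fun _ => Icc 1 N),
      (∏ a ∈ J.attach, α (p a.1 a.2)) *
          ((x : ℝ) * (hmax : ℝ) ^ (#J * #J) / (∏ a ∈ J.attach, (p a.1 a.2 : ℝ)) + 1) =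
        (x : ℝ) * (hmax : ℝ) ^ (#J * #J) * ∏ a ∈ J.attach, (α (p a.1 a.2) / p a.1 a.2) +
          ∏ a ∈ J.attach, α (p a.1 a.2) := by
    intro p _
    rw [prod_div_distrib]
    ring
  rw [sum_congr rfl hsplit, sum_add_distrib, ← mul_sum,
    sum_pi_prod_eq_pow J (Icc 1 N) (fun d => α d / d), sum_pi_prod_eq_pow J (Icc 1 N) α]

end TaoTeravainen

end Literature.Barriers.Parity
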